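import Literature.NumberTheory.Automorphic.AshSmithTheoryHeckeTrivialCharacterProofs
import Literature.NumberTheory.Automorphic.AshSmithTheoryHeckeDegreeZeroProofs
import Literature.NumberTheory.Automorphic.CompletedCohomologyHeckeAlgebraGLnHolds
import Literature.NumberTheory.Automorphic.HeckeSeriesCosetCount
import Literature.NumberTheory.Automorphic.WhittakerCoeffLocalDatum
import Literature.NumberTheory.Automorphic.AdicCompletionResidueCard
import Mathlib.Algebra.Polynomial.Reverse
import HarnessLib

/-!
# Ash (2003), *Smith theory and Hecke operators* — proofs towards the named fact
# `Ash2003_inducedRayClassCharacter_attached`: the Hecke eigenvalues of `[1] ∈ H⁰(X(M), F)` and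
# Theorem 1.1 for the trivial character

Topic `NumberTheory/Automorphic`; companion of `Literature.NumberTheory.Automorphic.AshSmithTheoryHecke`
(the named fact `Ash2003_inducedRayClassCharacter_attached` = A. Ash, *Smith theory and Hecke
operators*, J. Algebra **259** (2003) 43–58 [Ash2003], Thm. 1.1 / Cor. 4.4: for every mod-`p` ray
class character `θ` of `ℚ(ζ_p)` modulo `(pN)`, `Ind θ` is attached to a Hecke eigenclass in
`H^*(X(pN), F)`).  This file settles the case of the TRIVIAL character `θ = 𝟙` in the tree's typing:

* `Ash2003.exists_isEigenclass_isAttached_of_isGaloisAvatar_one`: for a prime `p`, `N ≥ 1`, a field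
  `F` of characteristic `p` and a Galois avatar `ϑ` of the trivial character of `Cl^{(pN)}(ℚ(ζ_p))`,
  there are `i` (`= 0`), a Hecke eigenclass `α ∈ H^i(X(pN), F)` (the class `[1]` of the constant
  function, `Ash2003.exists_isEigenclass_zero` of `AshSmithTheoryHeckeDegreeZeroProofs`) and
  eigenvalues `a` (`a(l,k) = #(K_f(pN) s_{l,k} K_f(pN) / K_f(pN))`) with `Ash2003.IsEigenclass … α a`
  and `Ash2003.IsAttached p (pN) (Ind ϑ) a` — i.e. the conclusion of the fact for `θ = 𝟙`.

What is proved on the way (the automorphic half of [Ash2003] in degree `0`, "`T_s` acts on the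
constants by `deg T_s`", with the degrees evaluated):

* `Ash2003.asIdeal_eq_span_residueCard`, `Ash2003.valued_localPrime`,
  `Ash2003.isUniformizingElement_localPrime`: a finite place `v` of `ℚ` is `v = (q_v)`, and the prime
  `q_v` is a uniformizer of `ℚ_v` (`|q_v|_v = exp(-1)`);
* `Ash2003.heckeElement_eq_ofLocal_heckeDiag`: the Hecke element `s_{l,k}` of the fact is the image
  of the local `t_k = diag(l,…,l,1,…,1) ∈ GL_n(ℚ_l)` (tree `heckeDiag`) under the local embedding
  `ιᵥ : GL_n(ℚ_v) → GL_n(𝔸_ℚ^∞)` (`BigHeckeGLn.ofLocal`);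
* `Ash2003.isUnramifiedLevel_finiteLevel`: the level `K_f(M)` is unramified at every `v ∤ M` in the
  sense of `ArithmeticQuotient.IsUnramifiedLevel` (`K_f(M) = K_f(M)ᵛ × GL_n(ℤ_v)`), so that by the
  local–global coset correspondence (`IsUnramifiedLevel.bijOn_localCoset` of
  `ArithmeticQuotientHeckeLocal`, [KhareThorne2017, §6.2])
  `#(K_f(M) s_{l,k} K_f(M) / K_f(M)) = #(GL_n(ℤ_l) t_k GL_n(ℤ_l) / GL_n(ℤ_l))`
  (`Ash2003.card_doubleCosetQuot_heckeElement`);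
* the local count and the `q`-binomial theorem are the tree's
  `sum_ncard_orbit_heckeDiag_mul_pow_eq_prod` (`HeckeSeriesCosetCount`:
  `∑_k (-1)^k l^{k(k-1)/2} #(K t_k K/K) x^k = ∏_{j<n} (1 - l^j x)`, the degrees being the numbers of
  subspaces of `𝔽_lⁿ`, Shimura (1971), Lemma 3.22–3.23); reversing the polynomial
  (`heckeFrobPoly_natCast_eq_prod`, Mathlib `Polynomial.reflect`) gives
  `Ash2003.heckeFrobPoly_card_doubleCosetQuot`:
  `∑_k (-1)^k l^{k(k-1)/2} a(l,k) X^{n-k} = ∏_{j<n} (X - l^j)` for the eigenvalues `a(l,k)` of `[1]`;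
* and `∏_{j<p-1} (X - l^j) = det(X - Ind(𝟙)(Frob_l))` in characteristic `p` is
  `Ash2003.hasFrobCharpolyAt_induce_of_isGaloisAvatar_one` (`AshSmithTheoryHeckeTrivialCharacterProofs`).

The general character `θ` of [Ash2003, Thm. 1.1] needs the Smith-theory argument of §§2–6 of the
paper (eigenclasses in positive degree at torsion-free level) and is not addressed here.

## References

* A. Ash, *Smith theory and Hecke operators*, J. Algebra 259 (2003) 43–58, Thm. 1.1, §2, Def. 0.1
  [Ash2003].
* G. Shimura, *Introduction to the arithmetic theory of automorphic functions* (1971), Ch. 3 §3.2,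
  Thm. 3.21, Lemmas 3.22–3.23 (degrees of the `T_k`, the `q`-binomial identity) [ShimuraIATAF1971].
* C. Khare, J. Thorne, *Potential automorphy and the Leopoldt conjecture*, Amer. J. Math. 139
  (2017), §6.2 (local–global Hecke operators) [KhareThorne2017].
-/

noncomputable section

open scoped NumberField
open IsDedekindDomain Polynomial MulAction ValuativeRel

namespace Literature.NumberTheory.Automorphic

/-! ### Pure algebra: reversing the `q`-binomial identity -/

section Reflect

variable {R : Type*} [CommRing R]

/-- `Polynomial.reflect` is additive over finite sums. [folklore] -/
theorem reflect_finset_sum {ι : Type*} (s : Finset ι) (f : ι → R[X]) (N : ℕ) :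
    reflect N (∑ i ∈ s, f i) = ∑ i ∈ s, reflect N (f i) := by
  classical
  refine Finset.induction_on s (by simp) fun a s ha ih => ?_
  rw [Finset.sum_insert ha, Finset.sum_insert ha, reflect_add, ih]

/-- `reflect 1 (1 - c X) = X - c`. [folklore] -/
theorem reflect_one_sub_C_mul_X (c : R) : reflect 1 (1 - C c * X : R[X]) = X - C c := by
  have h1 : reflect 1 (1 : R[X]) = X := by
    rw [← C_1, reflect_C, C_1, one_mul, pow_one]
  have h2 : reflect 1 (C c * X : R[X]) = C c := by
    rw [← pow_one (X : R[X]), reflect_C_mul_X_pow, revAt_le le_rfl, Nat.sub_self, pow_zero, mul_one]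
  rw [reflect_sub, h1, h2]

/-- `reflect m (∏_{i<m} (1 - q^i X)) = ∏_{i<m} (X - q^i)`: the reciprocal polynomial of
`∏_{i<m} (1 - q^i X)`. [folklore] -/
theorem reflect_prod_one_sub_C_pow_mul_X (q : R) (m : ℕ) :
    reflect m (∏ i ∈ Finset.range m, (1 - C (q ^ i) * X : R[X])) =
      ∏ i ∈ Finset.range m, (X - C (q ^ i)) := by
  have hdeg1 : ∀ i : ℕ, (1 - C (q ^ i) * X : R[X]).natDegree ≤ 1 := fun i => by
    refine (natDegree_sub_le _ _).trans (max_le (by simp) ?_)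
    refine (natDegree_mul_le).trans ?_
    rw [natDegree_C, zero_add]
    exact natDegree_X_le
  induction m with
  | zero => rw [Finset.prod_range_zero, Finset.prod_range_zero, ← C_1, reflect_C, pow_zero, mul_one]
  | succ m ih =>
    have hdegm : (∏ i ∈ Finset.range m, (1 - C (q ^ i) * X : R[X])).natDegree ≤ m := by
      refine (natDegree_prod_le _ _).trans ?_
      calc ∑ i ∈ Finset.range m, (1 - C (q ^ i) * X : R[X]).natDegree
          ≤ ∑ _i ∈ Finset.range m, 1 := Finset.sum_le_sum fun i _ => hdeg1 i
        _ = m := by simp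
    rw [Finset.prod_range_succ, Finset.prod_range_succ, reflect_mul _ _ hdegm (hdeg1 m), ih,
      reflect_one_sub_C_mul_X]

/-- **The `q`-binomial identity, reversed.** If natural numbers `a_0, …, a_n` satisfy
`∑_{i ≤ n} (-1)^i q^{i(i-1)/2} a_i X^i = ∏_{i<n} (1 - q^i X)` in `R[X]` (as the degrees
`a_i = #(K t_i K / K)` of the Hecke operators `T_i` of `GL_n` do, `sum_ncard_orbit_heckeDiag_mul_pow_eq_prod`
of `HeckeSeriesCosetCount`), then their Hecke–Frobenius polynomial (tree `heckeFrobPoly`,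
`∑_{i ≤ n} (-1)^i q^{i(i-1)/2} a_i X^{n-i}`) is `∏_{i<n} (X - q^i)` — apply `Polynomial.reflect n`.
[folklore] -/
theorem heckeFrobPoly_natCast_eq_prod {q n : ℕ} {a : ℕ → ℕ}
    (h : ∑ i ∈ Finset.range (n + 1),
        (-1 : R[X]) ^ i * (q : R[X]) ^ (i.choose 2) * (a i : R[X]) * X ^ i =
      ∏ i ∈ Finset.range n, (1 - (q : R[X]) ^ i * X)) :
    heckeFrobPoly q n (fun i => (a i : R)) = ∏ i ∈ Finset.range n, (X - C ((q : R) ^ i)) := by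
  have hL : ∀ i : ℕ, C ((-1 : R) ^ i * (q : R) ^ (i.choose 2) * (a i : R)) =
      (-1 : R[X]) ^ i * (q : R[X]) ^ (i.choose 2) * (a i : R[X]) := fun i => by
    simp only [map_mul, map_pow, map_neg, map_one, map_natCast]
  have hR : ∀ i : ℕ, C ((q : R) ^ i) = (q : R[X]) ^ i := fun i => by rw [map_pow, map_natCast]
  have hsum : ∑ i ∈ Finset.range (n + 1), C ((-1 : R) ^ i * (q : R) ^ (i.choose 2) * (a i : R)) * X ^ i =
      ∏ i ∈ Finset.range n, (1 - C ((q : R) ^ i) * X) :=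
    calc ∑ i ∈ Finset.range (n + 1), C ((-1 : R) ^ i * (q : R) ^ (i.choose 2) * (a i : R)) * X ^ i
        = ∑ i ∈ Finset.range (n + 1),
            (-1 : R[X]) ^ i * (q : R[X]) ^ (i.choose 2) * (a i : R[X]) * X ^ i :=
          Finset.sum_congr rfl fun i _ => by rw [hL]
      _ = ∏ i ∈ Finset.range n, (1 - (q : R[X]) ^ i * X) := h
      _ = ∏ i ∈ Finset.range n, (1 - C ((q : R) ^ i) * X) :=
          Finset.prod_congr rfl fun i _ => by rw [hR]
  have href := congrArg (reflect n) hsum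
  rw [reflect_prod_one_sub_C_pow_mul_X, reflect_finset_sum] at href
  rw [← href]
  unfold heckeFrobPoly
  refine Finset.sum_congr rfl fun i hi => ?_
  rw [Finset.mem_range, Nat.lt_succ_iff] at hi
  rw [reflect_C_mul_X_pow, revAt_le hi, Nat.choose_two_right]

end Reflect

namespace Ash2003

/-! ### Places of `ℚ`: `v = (q_v)`, and `q_v` is a uniformizer of `ℚ_v` -/

/-- **`v = (q_v)`** as ideals of `𝓞 ℚ`: `v ∩ ℤ = (q_v)` (`liesOver_span_residueCard`) and `ℤ → 𝓞 ℚ` is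
onto (Mathlib `Rat.int_algebraMap_surjective`). [folklore] -/
theorem asIdeal_eq_span_residueCard (v : HeightOneSpectrum (𝓞 ℚ)) :
    v.asIdeal = Ideal.span {(v.residueCard : 𝓞 ℚ)} := by
  have hsurj := Rat.int_algebraMap_surjective (𝓞 ℚ)
  have hV : v.asIdeal.under ℤ = Ideal.span {(v.residueCard : ℤ)} :=
    under_int_eq_span_of_natCast_mem v.isPrime.ne_top (residueCard_prime v)
      (Ideal.absNorm_mem v.asIdeal)
  calc v.asIdeal = (v.asIdeal.under ℤ).map (algebraMap ℤ (𝓞 ℚ)) :=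
        (Ideal.map_comap_of_surjective _ hsurj _).symm
    _ = Ideal.span {(v.residueCard : 𝓞 ℚ)} := by
        rw [hV, Ideal.map_span, Set.image_singleton, map_natCast]

/-- **`|q_v|_v = exp(-1)`**: the prime `q_v`, as an element of `ℚ_v` (`Ash2003.localPrime`), has
normalised valuation `exp(-1)` (Mathlib `intValuation_singleton` for the generator `q_v` of `v`).
[folklore] -/
theorem valued_localPrime (v : HeightOneSpectrum (𝓞 ℚ)) :
    Valued.v ((localPrime v : (v.adicCompletion ℚ)ˣ) : v.adicCompletion ℚ) =
      WithZero.exp (-1 : ℤ) := by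
  have h0 : (v.residueCard : 𝓞 ℚ) ≠ 0 := by exact_mod_cast (residueCard_prime v).ne_zero
  -- `Valued.v` on the image of `ℚ` is the `v`-adic valuation (stated through `algebraMap`)
  have hval : ∀ c : ℚ, Valued.v (algebraMap ℚ (v.adicCompletion ℚ) c) = v.valuation ℚ c :=
    fun c => HeightOneSpectrum.valuedAdicCompletion_eq_valuation' v c
  rw [coe_localPrime, show (v.residueCard : ℚ) = algebraMap (𝓞 ℚ) ℚ (v.residueCard : 𝓞 ℚ) by
      rw [map_natCast], hval, HeightOneSpectrum.valuation_of_algebraMap,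
    HeightOneSpectrum.intValuation_singleton _ h0 (asIdeal_eq_span_residueCard v)]

/-- **`q_v` is a uniformizer of `ℚ_v`**: a uniformizing element (`IsUniformizingElement`) of the
valuation ring of `ℚ_v` (`isUniformizingElement_of_valued_eq`). [folklore] -/
theorem isUniformizingElement_localPrime (v : HeightOneSpectrum (𝓞 ℚ)) :
    IsUniformizingElement ((localPrime v : (v.adicCompletion ℚ)ˣ) : v.adicCompletion ℚ) :=
  isUniformizingElement_of_valued_eq ℚ v (valued_localPrime v)

/-! ### The Hecke element is local, and the level `K_f(M)` is unramified at `v ∤ M` -/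

/-- **`s_{l,k} = ιᵥ(t_k)`**: the Hecke element `heckeElement n v k = diag(l,…,l,1,…,1)` (`k` local
ideles of `l = q_v`) is the image under the local embedding `ιᵥ = BigHeckeGLn.ofLocal n ℚ v` of the
local diagonal matrix `heckeDiag n l k ∈ GL_n(ℚ_v)` (compare `BigHeckeGLn.heckeElement_eq_ofLocal`).
[folklore] -/
theorem heckeElement_eq_ofLocal_heckeDiag (n : ℕ) (v : HeightOneSpectrum (𝓞 ℚ)) (k : ℕ) :
    heckeElement n v k = BigHeckeGLn.ofLocal n ℚ v (heckeDiag n (localPrime v) k) := by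
  refine BigHeckeGLn.ext_localComponent fun w => Matrix.GeneralLinearGroup.ext fun a b => ?_
  by_cases hw : w = v
  · subst hw
    rw [BigHeckeGLn.localComponent_ofLocal, BigHeckeGLn.coe_localComponent_apply, heckeElement,
      coe_glDiagonal, coe_heckeDiag, Matrix.diagonal_apply, Matrix.diagonal_apply]
    split_ifs with hab hi
    · exact uniformizerIdele_apply_self ℚ w _
    · rfl
    · rfl
  · rw [BigHeckeGLn.localComponent_ofLocal_of_ne hw, BigHeckeGLn.coe_localComponent_apply,
      heckeElement, coe_glDiagonal, Matrix.diagonal_apply, Units.val_one, Matrix.one_apply]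
    split_ifs with hab hi
    · exact uniformizerIdele_apply_of_ne ℚ v _ hw
    · rfl
    · rfl

/-- `v ∤ (M)` as ideals when `q_v ∤ M`. [folklore] -/
theorem not_asIdeal_dvd_span {v : HeightOneSpectrum (𝓞 ℚ)} {M : ℕ} (hv : ¬ v.residueCard ∣ M) :
    ¬ v.asIdeal ∣ Ideal.span {(M : 𝓞 ℚ)} := fun h =>
  hv (residueCard_dvd_of_natCast_mem (Ideal.dvd_span_singleton.mp h))

/-- `(1, ιᵥ(g)) = GLn.ofLocal g`: the finite-adelic local embedding followed by `h ↦ (1, h)` is the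
adelic local embedding (whose archimedean component is `1`). [folklore] -/
theorem ofFinite_ofLocal (n : ℕ) (v : HeightOneSpectrum (𝓞 ℚ)) (g : GL (Fin n) (v.adicCompletion ℚ)) :
    GLn.ofFinite n ℚ (BigHeckeGLn.ofLocal n ℚ v g) = GLn.ofLocal n ℚ v g := by
  refine Matrix.GeneralLinearGroup.ext fun i j => Prod.ext ?_ ?_
  · rw [GLn.coe_ofFinite_apply, GLn.fst_coe_ofLocal_apply]
  · rw [GLn.coe_ofFinite_apply]
    rfl

/-- **The level `K_f(M)` is unramified at `v ∤ M`** (`M ≠ 0`) in the sense of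
`ArithmeticQuotient.IsUnramifiedLevel` for the place structure
`(GL_n(ℚ_v), GL_n(ℤ_v), ιᵥ, (·)_v)`: `ιᵥ(GL_n(ℤ_v)) ≤ K_f(M)` (the principal congruence subgroup is
maximal at `v ∤ M`, `isMaximalAt_principalCongruenceLevel`) and the `v`-components of `K_f(M)` are
integral ([Ash2003, §2]: `K_f(M) = ∏_{l ∤ M} GL_n(ℤ_l) × ∏_{l^e ∥ M} K_l(l^e)`). [cite: Ash2003, §2] -/
theorem isUnramifiedLevel_finiteLevel (n : ℕ) {M : ℕ} (hM : M ≠ 0) {v : HeightOneSpectrum (𝓞 ℚ)}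
    (hv : ¬ v.residueCard ∣ M) :
    ArithmeticQuotient.IsUnramifiedLevel
      (valuedCongruenceSubgroup (Fin n) (1 : WithZero (Multiplicative ℤ)))
      (BigHeckeGLn.ofLocal n ℚ v) (BigHeckeGLn.localComponent n ℚ v) (finiteLevel n M) := by
  refine BigHeckeGLn.isUnramifiedLevel_of_le ?_ fun u hu =>
    BigHeckeGLn.localComponent_mem_valuedCongruenceSubgroup_one
      (comap_ofFinite_principalCongruenceLevel_le n ℚ _ hu) v
  rintro _ ⟨g, hg, rfl⟩
  rw [mem_finiteLevel_iff, ofFinite_ofLocal]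
  exact isMaximalAt_principalCongruenceLevel n ℚ v (span_natCast_ne_zero hM)
    (not_asIdeal_dvd_span hv) ⟨g, hg, rfl⟩

/-! ### The eigenvalues of `[1]`: `#(K_f(M) s_{l,k} K_f(M) / K_f(M)) = #(GL_n(ℤ_l) t_k GL_n(ℤ_l) / GL_n(ℤ_l))` -/

/-- **Local–global count**: for `v ∤ M` the number of single cosets in `K_f(M) s_{l,k} K_f(M)` is the
number of single cosets in the local double coset `GL_n(ℤ_l) diag(l,…,l,1,…,1) GL_n(ℤ_l)`
(`IsUnramifiedLevel.bijOn_localCoset`, [KhareThorne2017, §6.2]; [Ash2003, §2, p. 47]: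
"`K_l s_l K_l = ∐_i s_{i,l} K_l`"), the latter in the `ValuativeRel` language of the tree's local
Hecke files (`glInt`, `glInt_adicCompletion_eq`). [cite: Ash2003, §2] -/
theorem card_doubleCosetQuot_heckeElement (n : ℕ) {M : ℕ} (hM : M ≠ 0)
    {v : HeightOneSpectrum (𝓞 ℚ)} (hv : ¬ v.residueCard ∣ M) (k : ℕ) :
    (finite_doubleCosetQuot_finiteLevel n hM (heckeElement n v k)).toFinset.card =
      (orbit (glInt n (v.adicCompletion ℚ))
        ((heckeDiag n (Units.mk0 ((localPrime v : (v.adicCompletion ℚ)ˣ) : v.adicCompletion ℚ)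
            (isUniformizingElement_localPrime v).ne_zero) k : GL (Fin n) (v.adicCompletion ℚ)) :
          GL (Fin n) (v.adicCompletion ℚ) ⧸ glInt n (v.adicCompletion ℚ))).ncard := by
  have h := isUnramifiedLevel_finiteLevel n hM hv
  rw [← Set.ncard_eq_toFinset_card _ (finite_doubleCosetQuot_finiteLevel n hM (heckeElement n v k)),
    heckeElement_eq_ofLocal_heckeDiag, ← (h.bijOn_localCoset _).image_eq,
    (h.bijOn_localCoset _).injOn.ncard_image, Units.mk0_val, glInt_adicCompletion_eq]

/-- **The Hecke–Frobenius polynomial of the eigenvalues of `[1]` is `∏_{j<n} (X - l^j)`**: for `v ∤ M`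
(`M ≠ 0`, `l = q_v`) and the eigenvalues `a(l,k) = #(K_f(M) s_{l,k} K_f(M) / K_f(M))` of the
degree-`0` class `[1]` (`exists_isEigenclass_zero`), in any commutative ring of coefficients,
`∑_{k ≤ n} (-1)^k l^{k(k-1)/2} a(l,k) X^{n-k} = ∏_{j<n} (X - l^j)` — the degrees are the numbers of
subspaces of `𝔽_lⁿ` and Gauss's `q`-binomial identity (the tree's
`sum_ncard_orbit_heckeDiag_mul_pow_eq_prod`, Shimura (1971), Lemmas 3.22–3.23), reversed
(`heckeFrobPoly_natCast_eq_prod`). [cite: ShimuraIATAF1971, Ch. 3 §3.2, Lemma 3.23] -/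
theorem heckeFrobPoly_card_doubleCosetQuot (n : ℕ) {M : ℕ} (hM : M ≠ 0)
    {v : HeightOneSpectrum (𝓞 ℚ)} (hv : ¬ v.residueCard ∣ M) (F : Type*) [CommRing F] :
    heckeFrobPoly v.residueCard n
        (fun k => ((finite_doubleCosetQuot_finiteLevel n hM (heckeElement n v k)).toFinset.card : F)) =
      ∏ j ∈ Finset.range n, (X - C ((v.residueCard : F) ^ j)) := by
  have hsum := sum_ncard_orbit_heckeDiag_mul_pow_eq_prod (n := n)
    (isUniformizingElement_localPrime v) (X : F[X])
  rw [natCard_valuativeResidueField_adicCompletion_eq ℚ v] at hsum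
  simp_rw [← card_doubleCosetQuot_heckeElement n hM hv] at hsum
  exact heckeFrobPoly_natCast_eq_prod hsum

/-! ### Theorem 1.1 for the trivial character -/

/-- **[Ash2003, Thm. 1.1 / Cor. 4.4] for the trivial character `θ = 𝟙`.**  Let `p` be a prime,
`N ≥ 1`, `F` a field of characteristic `p` (a `ℤ/p`-algebra, with any topology) and
`ϑ : Γ_{ℚ(ζ_p)} → F^×` a Galois avatar of the trivial character of the ray class group of `ℚ(ζ_p)`
modulo `(pN)` (`Ash2003.IsGaloisAvatar … 1 ϑ`).  Then there are a degree `i`, a Hecke eigenclass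
`α ∈ H^i(X(pN), F)` with eigenvalues `a` (`Ash2003.IsEigenclass`) such that `Ind_{Γ_{ℚ(ζ_p)}}^{Γ_ℚ} ϑ`
is attached to `a` (`Ash2003.IsAttached`): namely `i = 0`, `α = [1]` the class of the constant
function (`exists_isEigenclass_zero`), `a(l,k) = #(K_f(pN) s_{l,k} K_f(pN) / K_f(pN))`, whose
Hecke–Frobenius polynomial `∏_{j<p-1} (X - l^j)` (`heckeFrobPoly_card_doubleCosetQuot`) is the
characteristic polynomial of `Ind(ϑ)(Frob_l) ∼ 𝟙 ⊕ ω ⊕ ⋯ ⊕ ω^{p-2}`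
(`hasFrobCharpolyAt_induce_of_isGaloisAvatar_one`), `Ind ϑ` being unramified at `l ∤ pN`
(`isUnramifiedAt_induce_of_isGaloisAvatar`).  This is the conclusion of the named fact
`Ash2003_inducedRayClassCharacter_attached` for `θ = 𝟙` (there with `p` odd, `p ∤ N`, `F = 𝔽̄_p`);
the general `θ` is the Smith-theory content of the paper. [cite: Ash2003, Thm. 1.1 and Cor. 4.4] -/
theorem exists_isEigenclass_isAttached_of_isGaloisAvatar_one (p : ℕ) [hp : Fact p.Prime] {N : ℕ}
    (hN : N ≠ 0) (F : Type) [Field F] [Algebra (ZMod p) F] [TopologicalSpace F]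
    (ϑ : GaloisRepresentations.FramedGaloisRep (CyclotomicField p ℚ) F 1)
    (hϑ : IsGaloisAvatar
      (modulus_ne_bot (CyclotomicField p ℚ) (mul_ne_zero (Nat.Prime.ne_zero hp.out) hN))
      (1 : GaloisRepresentations.RayClassGroup (modulus (CyclotomicField p ℚ) (p * N)) →* Fˣ) ϑ) :
    ∃ (i : ℕ) (α : cohomology (p - 1) (p * N) F i) (a : HeightOneSpectrum (𝓞 ℚ) → ℕ → F),
      IsEigenclass (p - 1) (p * N) F i α a ∧
        IsAttached p (p * N)
          (GaloisRepresentations.FramedGaloisRep.induce ℚ (finrank_cyclotomicField p) ϑ) a := by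
  have hM : p * N ≠ 0 := mul_ne_zero hp.out.ne_zero hN
  obtain ⟨α, hα⟩ := exists_isEigenclass_zero (p - 1) hM F
  refine ⟨0, α, _, hα, fun v hv => ⟨isUnramifiedAt_induce_of_isGaloisAvatar p hN 1 ϑ hϑ hv, ?_⟩⟩
  have hv' : ¬ v.residueCard ∣ p * N := fun h => hv (h.trans (Dvd.intro_left p rfl))
  have e : heckeFrobPoly v.residueCard ((p - 1) * 1)
      (fun k => ((finite_doubleCosetQuot_finiteLevel (p - 1) hM
        (heckeElement (p - 1) v k)).toFinset.card : F)) =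
      ∏ j ∈ Finset.range (p - 1), (X - C ((v.residueCard : F) ^ j)) := by
    rw [mul_one]
    exact heckeFrobPoly_card_doubleCosetQuot (p - 1) hM hv' F
  rw [e]
  exact hasFrobCharpolyAt_induce_of_isGaloisAvatar_one p hN ϑ hϑ hv

end Ash2003

end Literature.NumberTheory.Automorphic
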